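import Mathlib
import Literature.Computability.AlgebraicComplexity.PaddedPermanentPartials
import Literature.Computability.AlgebraicComplexity.ApolarityAction
import Literature.Computability.AlgebraicComplexity.OrbitClosureProofs
import Literature.NumberTheory.DiophantineGeometry.SchurWeylPlethysm
import Summits.ValiantsHypothesis.ValiantsHypothesis.Theses.ValuativeGCT

/-!
# Four-row pencil transfer, part 1: tools (crux `ValuativeGCT.ValuativeFlip`, stmt-ValiantsHypothesis-12624,
# line `four-row-count`, stub `stub_fourRowPencilRank`; wall-breaker axis "representation stability `m ↔ m + 1`")

The per side of the four-row count is REPRESENTATION-STABLE in the padding parameter `m`: the four-row tangent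
span of `g · X₀₀^{m-n} per_n` (the quantity of `stub_fourRowPencilRank`),
`V(g) = span{X_a · (∂_b (g · pp))|₄ : a kept, b}` (`|₄` = keep the last four lexicographic variables), depends on
`g` only through the four-variable linear forms `ρ_g(X_c) = (g · X_c)|₄`, and for the padded permanent it contains
`ρ_g(X₀₀)^{m-n} · span{X_a · Per_c(M(y))}` where `M(y)` is the four-variable pencil `ρ_g` induces on the block.  So one
pencil of `n × n` scalar matrices serves EVERY `m ≥ n + 1` at once (part 2,
`ValuativeGCTValuativeFlipFourRowPencilTransfer`: an explicit `g ∈ GL_{m²}` realising a given pencil), and the stub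
reduces to one `m`-free inequality about `per_n`.

Relation to the sibling helper `ValuativeGCTValuativeFlipFourRowTransfer` (wall-breaker k4, landed first;
`frt_finrank_fourRowSpan_ge`, `fourRowPencilRank_of_pencilCertificate`): that file realises pencils with FOUR CELLS CARRYING
INDEPENDENT FORMS at every `m ≥ n` (bottom included); the present pair of files proves the complementary statement for
ARBITRARY pencils (no invertible-minor hypothesis) on the padded range `m ≥ n + 1`, through an abstract interface
(`frp_finrank_le_of_forms`: any `g` with prescribed kept column parts) that other realisations can reuse.

This file: the `m`-independent identities.
* `frp_linSubst_pderiv_eq_sum` — inverse chain rule `g · (∂_c p) = Σ_b (g⁻¹)_{cb} ∂_b (g · p)`;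
* `frp_X_mul_aeval_linSubst_pderiv_mem_span` — hence `X_a · (g · ∂_c pp)|₄ ∈ V(g)`;
* `frp_aeval_linSubst` — `(g · p)|₄ = p(ρ_g)` (restriction after substitution is substitution by the restricted forms);
* `frp_pderiv_paddedPerFormLex_block`, `frp_aeval_pderiv_paddedPerFormLex_block` — `∂_{ι b} pp = X₀₀^{m-n} · ι(∂_b per_B)`
  and its substitution;
* `frp_aeval_pderiv_perPoly_equiv` — transport of permanental minors `per_B ↔ per_{Fin n}` along `Fin n ≃ B`.

Sources: Mulmuley–Sohoni 2001 §4 (padded permanent); this crux's line card `Cruxes/ValuativeFlip/Lines/four-row-count.md`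
(§Stubs, `stub_fourRowPencilRank`); M. Marcus, F. May, *The permanent function*, Canad. J. Math. 14 (1962) (the pencil
heuristics); elementary multivariable calculus (chain rule) otherwise.
-/

set_option linter.dupNamespace false

namespace Summit.ValiantsHypothesis.ValiantsHypothesis.Theorems.ValuativeFlip

open MvPolynomial
open scoped BigOperators Matrix
open Literature.NumberTheory.DiophantineGeometry Literature.Computability.AlgebraicComplexity

noncomputable section

/-! ## Inverse chain rule and membership in the tangent span -/

/-- **Inverse chain rule.** For invertible `g`: `g · (∂_c p) = Σ_b (g⁻¹)_{c b} • ∂_b (g · p)` (from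
`∂_b (g · p) = Σ_c g_{b c} • g · (∂_c p)`, `pderiv_linSubst_eq_sum`). [folklore] -/
theorem frp_linSubst_pderiv_eq_sum {σ : Type*} [Fintype σ] [DecidableEq σ] (g : GL σ ℂ) (c : σ)
    (p : MvPolynomial σ ℂ) :
    linSubst σ ℂ (g : Matrix σ σ ℂ) (pderiv c p) =
      ∑ b, ((g⁻¹ : GL σ ℂ) : Matrix σ σ ℂ) c b • pderiv b (linSubst σ ℂ (g : Matrix σ σ ℂ) p) := by
  simp_rw [pderiv_linSubst_eq_sum, Finset.smul_sum, smul_smul]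
  rw [Finset.sum_comm]
  simp_rw [← Finset.sum_smul]
  have h1 : ∀ c', ∑ b, ((g⁻¹ : GL σ ℂ) : Matrix σ σ ℂ) c b * (g : Matrix σ σ ℂ) b c' =
      (1 : Matrix σ σ ℂ) c c' := by
    intro c'
    rw [← Matrix.mul_apply, Units.inv_mul]
  simp_rw [h1, Matrix.one_apply, ite_smul, one_smul, zero_smul, Finset.sum_ite_eq, Finset.mem_univ,
    if_true]

/-- **The restricted translates of the partials lie in the four-row tangent span.**  For any family of
"kept" variables `a` (a subtype `K`), any substitution `κ` and invertible `g`: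
`X_a · κ(g · ∂_c p) ∈ span{X_a · κ(∂_b (g · p)) : a ∈ K, b}` (inverse chain rule, linearity). [folklore] -/
theorem frp_X_mul_aeval_linSubst_pderiv_mem_span {σ : Type*} [Fintype σ] [DecidableEq σ]
    (K : σ → Prop) (κ : MvPolynomial σ ℂ →ₐ[ℂ] MvPolynomial σ ℂ) (g : GL σ ℂ) (p : MvPolynomial σ ℂ)
    (a : {a : σ // K a}) (c : σ) :
    (X a.1 : MvPolynomial σ ℂ) * κ (linSubst σ ℂ (g : Matrix σ σ ℂ) (pderiv c p)) ∈
      Submodule.span ℂ (Set.range fun ab : {a : σ // K a} × σ =>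
        (X ab.1.1 : MvPolynomial σ ℂ) * κ (pderiv ab.2 (linSubst σ ℂ (g : Matrix σ σ ℂ) p))) := by
  rw [frp_linSubst_pderiv_eq_sum, map_sum, Finset.mul_sum]
  refine Submodule.sum_mem _ fun b _ => ?_
  rw [map_smul, mul_smul_comm]
  exact Submodule.smul_mem _ _ (Submodule.subset_span ⟨(a, b), rfl⟩)

/-- **Restriction after substitution.** For any substitution `κ = aeval keep` and any matrix `M`:
`κ (M · p) = p(ρ)` with `ρ_c = Σ_j M_{j c} • keep_j` (both sides are algebra maps agreeing on variables). [folklore] -/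
theorem frp_aeval_linSubst {σ : Type*} [Fintype σ] (M : Matrix σ σ ℂ) (keep : σ → MvPolynomial σ ℂ)
    (p : MvPolynomial σ ℂ) :
    aeval keep (linSubst σ ℂ M p) = aeval (fun c => ∑ j, M j c • keep j) p := by
  have h : (aeval keep).comp (linSubst σ ℂ M) = aeval (fun c => ∑ j, M j c • keep j) := by
    rw [linSubst, comp_aeval]
    congr 1
    funext c
    simp only [map_sum, map_smul, aeval_X]
  exact congrArg (fun φ : MvPolynomial σ ℂ →ₐ[ℂ] MvPolynomial σ ℂ => φ p) h

/-! ## Partials of the padded permanent at block positions (lexicographic variables) -/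

section Padded

variable (n m : ℕ) [NeZero m]

omit [NeZero m] in
/-- The block embedding into the lexicographic matrix variables, `b ↦ toLex (b.1, b.2)`, is injective. [folklore] -/
theorem frp_blockLex_injective :
    Function.Injective (fun ij : BlockIdx n m × BlockIdx n m => (toLex ((ij.1 : Fin m), (ij.2 : Fin m)) : MatIdx m)) := by
  intro a b h
  have h' := toLex.injective h
  simp only [Prod.mk.injEq] at h'
  exact Prod.ext (Subtype.ext h'.1) (Subtype.ext h'.2)

/-- **Partial of the padded permanent in a block variable (lexicographic variables).**
`∂_{ι b} (X₀₀^{m-n} · ι per_B) = X₀₀^{m-n} · ι(∂_b per_B)` for `pp = paddedPerFormLex ℂ n m` and the block embedding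
`ι b = toLex (b.1, b.2)` (transport of `pderiv_paddedPerPoly_block` along `rename toLex`). [Mulmuley–Sohoni 2001 §4; folklore] -/
theorem frp_pderiv_paddedPerFormLex_block (b : BlockIdx n m × BlockIdx n m) :
    pderiv (toLex ((b.1 : Fin m), (b.2 : Fin m)) : MatIdx m) (paddedPerFormLex ℂ n m) =
      (X (toLex ((0 : Fin m), (0 : Fin m))) : MvPolynomial (MatIdx m) ℂ) ^ (m - n) *
        rename (fun ij : BlockIdx n m × BlockIdx n m => (toLex ((ij.1 : Fin m), (ij.2 : Fin m)) : MatIdx m))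
          (pderiv b (perPoly (BlockIdx n m) ℂ)) := by
  have h1 : (toLex ((b.1 : Fin m), (b.2 : Fin m)) : MatIdx m) =
      (toLex : Fin m × Fin m ≃ MatIdx m) ((b.1 : Fin m), (b.2 : Fin m)) := rfl
  rw [paddedPerFormLex, h1, pderiv_rename (toLex : Fin m × Fin m ≃ MatIdx m).injective,
    pderiv_paddedPerPoly_block, map_mul, map_pow, rename_X, rename_rename]
  rfl

/-- Substituting four-variable (or any) forms `ρ` into the block partial:
`(∂_{ι b} pp)(ρ) = ρ(X₀₀)^{m-n} · (∂_b per_B)(ρ ∘ ι)`. [folklore] -/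
theorem frp_aeval_pderiv_paddedPerFormLex_block {S : Type*} [CommRing S] [Algebra ℂ S] (ρ : MatIdx m → S)
    (b : BlockIdx n m × BlockIdx n m) :
    aeval ρ (pderiv (toLex ((b.1 : Fin m), (b.2 : Fin m)) : MatIdx m) (paddedPerFormLex ℂ n m)) =
      ρ (toLex ((0 : Fin m), (0 : Fin m))) ^ (m - n) *
        aeval (fun ij : BlockIdx n m × BlockIdx n m => ρ (toLex ((ij.1 : Fin m), (ij.2 : Fin m))))
          (pderiv b (perPoly (BlockIdx n m) ℂ)) := by
  rw [frp_pderiv_paddedPerFormLex_block, map_mul, map_pow, aeval_X, aeval_rename]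
  rfl

/-- **Transport of permanental minors along a relabelling of the block.**  For `e : Fin n ≃ B` and any
substitution `f` of the `Fin n × Fin n` variables: `(∂_b per_B)(f ∘ (e⁻¹ × e⁻¹)) = (∂_{(e⁻¹ × e⁻¹) b} per_{Fin n})(f)`
(`rename_perPoly_equiv`, `pderiv_rename`, `aeval_rename`). [folklore] -/
theorem frp_aeval_pderiv_perPoly_equiv {B : Type*} [Fintype B] [DecidableEq B] {S : Type*} [CommRing S]
    [Algebra ℂ S] (e : Fin n ≃ B) (f : Fin n × Fin n → S) (b : B × B) :
    aeval (fun ij : B × B => f (Prod.map e.symm e.symm ij)) (pderiv b (perPoly B ℂ)) =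
      aeval f (pderiv (Prod.map e.symm e.symm b) (perPoly (Fin n) ℂ)) := by
  have hinj : Function.Injective (Prod.map e.symm e.symm : B × B → Fin n × Fin n) :=
    (e.symm.prodCongr e.symm).injective
  rw [← rename_perPoly_equiv (k := ℂ) e.symm, pderiv_rename hinj, aeval_rename]
  rfl

end Padded

end

/-! ## From restricted forms to the rank inequality (all `m`, abstract `g`) -/

section Realization

/-- Lexicographic index of the matrix position `(i, j)`: `j + m·i`. [folklore] -/
theorem frp_symm_toLex_val {m : ℕ} (i j : Fin m) :
    (((matIdxEquiv m).symm (toLex (i, j)) : Fin (m * m)) : ℕ) = (j : ℕ) + m * (i : ℕ) := by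
  have h : (matIdxEquiv m).symm (toLex (i, j)) = finProdFinEquiv (i, j) := by
    apply (matIdxEquiv m).injective
    rw [OrderIso.apply_symm_apply, matIdxEquiv_apply, Equiv.symm_apply_apply]
  rw [h]
  rfl

/-- **Abstract realization ⇒ rank transfer.**  Let `eK : Fin 4 ≃ K` enumerate the four kept positions, `g ∈ GL_{m²}`,
`A` a four-pencil of `n × n` scalar matrices and `e : Fin n ≃ B` a labelling of the block.  If the kept parts of the
columns of `g` are: `X_{eK 0}` (to the power `m - n`) at the padding position `(0,0)`, and the pencil forms
`Σ_u A u (e⁻¹ i, e⁻¹ j) • X_{eK u}` at the block positions `(i, j)`, then the four-row tangent span of `g · X₀₀^{m-n} per_n`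
(the span of `stub_fourRowPencilRank`) has dimension at least
`dim span{X_u · (∂_c per_n)(M_A) : u, c}`, `M_A(c) = Σ_u A u c • X_u` — an `m`-FREE quantity.  Mechanism: the span
contains `X_{eK u} · (g · ∂_c pp)|₄ = X_{eK 0}^{m-n} · ι(X_u · (∂ per_n)(M_A))` (inverse chain rule, restriction after
substitution, block partials), and `q ↦ X_{eK 0}^{m-n} · ι q` (`ι = rename eK`) is an injective linear map.
[this file; line card `four-row-count` §Stubs] -/
theorem frp_finrank_le_of_forms {n m : ℕ} [NeZero m]
    (eK : Fin 4 ≃ {a : MatIdx m // m * m ≤ (((matIdxEquiv m).symm a : Fin (m * m)) : ℕ) + 4})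
    (g : GL (MatIdx m) ℂ) (A : Fin 4 → Fin n × Fin n → ℂ) (e : Fin n ≃ BlockIdx n m)
    (h0 : (∑ j : MatIdx m, (g : Matrix (MatIdx m) (MatIdx m) ℂ) j (toLex ((0 : Fin m), (0 : Fin m))) •
        (fun i : MatIdx m => if m * m ≤ (((matIdxEquiv m).symm i : Fin (m * m)) : ℕ) + 4 then
          (MvPolynomial.X i : MvPolynomial (MatIdx m) ℂ) else 0) j) ^ (m - n) =
        (X (eK 0).1 : MvPolynomial (MatIdx m) ℂ) ^ (m - n))
    (hB : ∀ b : BlockIdx n m × BlockIdx n m,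
      ∑ j : MatIdx m, (g : Matrix (MatIdx m) (MatIdx m) ℂ) j (toLex ((b.1 : Fin m), (b.2 : Fin m))) •
        (fun i : MatIdx m => if m * m ≤ (((matIdxEquiv m).symm i : Fin (m * m)) : ℕ) + 4 then
          (MvPolynomial.X i : MvPolynomial (MatIdx m) ℂ) else 0) j =
        rename (fun u : Fin 4 => (eK u).1) (∑ u : Fin 4, A u (e.symm b.1, e.symm b.2) • (X u : MvPolynomial (Fin 4) ℂ))) :
    Module.finrank ℂ ↥(Submodule.span ℂ (Set.range fun uc : Fin 4 × (Fin n × Fin n) =>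
        (MvPolynomial.X uc.1 : MvPolynomial (Fin 4) ℂ) *
          MvPolynomial.aeval (fun c : Fin n × Fin n => ∑ u : Fin 4, A u c • (MvPolynomial.X u : MvPolynomial (Fin 4) ℂ))
            (MvPolynomial.pderiv uc.2 (perPoly (Fin n) ℂ)))) ≤
      Module.finrank ℂ ↥(Submodule.span ℂ (Set.range fun ab : {a : MatIdx m // m * m ≤ (((matIdxEquiv m).symm a : Fin (m * m)) : ℕ) + 4} × MatIdx m => (MvPolynomial.X ab.1.1 : MvPolynomial (MatIdx m) ℂ) * MvPolynomial.aeval (fun i : MatIdx m => if m * m ≤ (((matIdxEquiv m).symm i : Fin (m * m)) : ℕ) + 4 then (MvPolynomial.X i : MvPolynomial (MatIdx m) ℂ) else 0) (MvPolynomial.pderiv ab.2 (linSubst (MatIdx m) ℂ ((g : GL (MatIdx m) ℂ) : Matrix (MatIdx m) (MatIdx m) ℂ) (paddedPerFormLex ℂ n m))))) := by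
  classical
  -- notation
  set keep : MatIdx m → MvPolynomial (MatIdx m) ℂ := fun i =>
    if m * m ≤ (((matIdxEquiv m).symm i : Fin (m * m)) : ℕ) + 4 then (MvPolynomial.X i : MvPolynomial (MatIdx m) ℂ) else 0
    with hkeep
  set τ : Fin 4 → MatIdx m := fun u => (eK u).1 with hτ
  set MA : Fin n × Fin n → MvPolynomial (Fin 4) ℂ := fun c => ∑ u : Fin 4, A u c • (X u : MvPolynomial (Fin 4) ℂ)
    with hMA
  set F : {a : MatIdx m // m * m ≤ (((matIdxEquiv m).symm a : Fin (m * m)) : ℕ) + 4} × MatIdx m →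
      MvPolynomial (MatIdx m) ℂ := fun ab => (X ab.1.1 : MvPolynomial (MatIdx m) ℂ) *
        aeval keep (pderiv ab.2 (linSubst (MatIdx m) ℂ ((g : GL (MatIdx m) ℂ) : Matrix (MatIdx m) (MatIdx m) ℂ)
          (paddedPerFormLex ℂ n m))) with hF
  set G : Fin 4 × (Fin n × Fin n) → MvPolynomial (Fin 4) ℂ := fun uc =>
      (X uc.1 : MvPolynomial (Fin 4) ℂ) * aeval MA (pderiv uc.2 (perPoly (Fin n) ℂ)) with hG
  set V : Submodule ℂ (MvPolynomial (MatIdx m) ℂ) := Submodule.span ℂ (Set.range F) with hV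
  set S : Submodule ℂ (MvPolynomial (Fin 4) ℂ) := Submodule.span ℂ (Set.range G) with hS
  -- the injective linear map `q ↦ X_{τ 0}^{m-n} · rename τ q`
  have hτinj : Function.Injective τ := Subtype.val_injective.comp eK.injective
  set Φ : MvPolynomial (Fin 4) ℂ →ₐ[ℂ] MvPolynomial (MatIdx m) ℂ := rename τ with hΦ
  have hΦinj : Function.Injective Φ := rename_injective τ hτinj
  set p0 : MvPolynomial (MatIdx m) ℂ := (X (τ 0) : MvPolynomial (MatIdx m) ℂ) ^ (m - n) with hp0
  have hp0ne : p0 ≠ 0 := pow_ne_zero _ (X_ne_zero _)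
  set L : MvPolynomial (Fin 4) ℂ →ₗ[ℂ] MvPolynomial (MatIdx m) ℂ :=
    (LinearMap.mulLeft ℂ p0) ∘ₗ Φ.toLinearMap with hL
  have hLinj : Function.Injective L := by
    intro x y hxy
    simp only [hL, LinearMap.coe_comp, Function.comp_apply, LinearMap.mulLeft_apply, AlgHom.toLinearMap_apply] at hxy
    exact hΦinj (mul_left_cancel₀ hp0ne hxy)
  -- the restricted forms
  set ρ : MatIdx m → MvPolynomial (MatIdx m) ℂ := fun c =>
    ∑ j : MatIdx m, (g : Matrix (MatIdx m) (MatIdx m) ℂ) j c • keep j with hρ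
  have hρB : (fun ij : BlockIdx n m × BlockIdx n m => ρ (toLex ((ij.1 : Fin m), (ij.2 : Fin m)))) =
      fun ij : BlockIdx n m × BlockIdx n m => (fun c => Φ (MA c)) (Prod.map e.symm e.symm ij) := by
    funext ij
    simp only [hρ, hΦ, hMA]
    exact hB ij
  -- every generator of `S` is mapped into `V`
  have hgen : ∀ uc : Fin 4 × (Fin n × Fin n), L (G uc) ∈ V := by
    rintro ⟨u', c'⟩
    set b : BlockIdx n m × BlockIdx n m := Prod.map e e c' with hb
    have hc' : Prod.map e.symm e.symm b = c' := by ext <;> simp [hb]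
    have hmem := frp_X_mul_aeval_linSubst_pderiv_mem_span
      (fun a : MatIdx m => m * m ≤ (((matIdxEquiv m).symm a : Fin (m * m)) : ℕ) + 4) (aeval keep) g
      (paddedPerFormLex ℂ n m) (eK u') (toLex ((b.1 : Fin m), (b.2 : Fin m)))
    have hcalc : (X (eK u').1 : MvPolynomial (MatIdx m) ℂ) *
        aeval keep (linSubst (MatIdx m) ℂ ((g : GL (MatIdx m) ℂ) : Matrix (MatIdx m) (MatIdx m) ℂ)
          (pderiv (toLex ((b.1 : Fin m), (b.2 : Fin m))) (paddedPerFormLex ℂ n m))) = L (G (u', c')) := by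
      rw [frp_aeval_linSubst, frp_aeval_pderiv_paddedPerFormLex_block]
      change (X (τ u') : MvPolynomial (MatIdx m) ℂ) * (ρ (toLex ((0 : Fin m), (0 : Fin m))) ^ (m - n) * _) = _
      rw [hρB, frp_aeval_pderiv_perPoly_equiv n e (fun c => Φ (MA c)) b, hc']
      have hcomp : aeval (fun c => Φ (MA c)) (pderiv c' (perPoly (Fin n) ℂ)) =
          Φ (aeval MA (pderiv c' (perPoly (Fin n) ℂ))) := by
        rw [← comp_aeval, AlgHom.comp_apply]
      have hρ0 : ρ (toLex ((0 : Fin m), (0 : Fin m))) ^ (m - n) = p0 := h0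
      rw [hcomp, hρ0]
      simp only [hL, hG, LinearMap.coe_comp, Function.comp_apply, LinearMap.mulLeft_apply,
        AlgHom.toLinearMap_apply, map_mul, hΦ, rename_X]
      ring
    rw [← hcalc]
    exact hmem
  have hle : S.map L ≤ V := by
    rw [hS, Submodule.map_span, Submodule.span_le]
    rintro _ ⟨_, ⟨uc, rfl⟩, rfl⟩
    exact hgen uc
  haveI : Module.Finite ℂ ↥V := FiniteDimensional.span_of_finite ℂ (Set.finite_range F)
  calc Module.finrank ℂ ↥S = Module.finrank ℂ ↥(S.map L) :=
        LinearEquiv.finrank_eq (Submodule.equivMapOfInjective L hLinj S)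
    _ ≤ Module.finrank ℂ ↥V := Submodule.finrank_mono hle

end Realization

end Summit.ValiantsHypothesis.ValiantsHypothesis.Theorems.ValuativeFlip
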